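import Mathlib
import Summits.Ventures.PercRepro2.Tail2D
import Summits.Ventures.PercRepro2.Tail2DSP
import Summits.Ventures.PercRepro2.Tail2DExchange
import Summits.Ventures.PercRepro2.Tail2DThreePoint
import Summits.Ventures.PercRepro2.Tail2DPairSign

/-!
# The flow-two step, part 1: cone monotonicity, the `m1` sign rule and the absorption lemmas
(seat mine-b, cell pub-perc-repro2)

Ingredients of `Tail2DFlowTwo.lean` (the six-point convolution step of the two-dimensional tail
calculus): the absorption inequality `absorb` and the cancellation `chain'`; `Δ₁ log T` / `Δ₂ log T`
non-increasing on their full cones (`d1_cone`, `d2_cone`); the `m1` cross bracket `crossB1` with the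
pair-coefficient sign rule `pair1_nonpos` (level distance ≤ 1; the `m2` rule is `pair_coeff_nonpos`,
Tail2DPairSign.lean); and the six absorption lemmas `abs2_E0`, `abs2_Em1`, `abs2_Wm2` (`m2`) and
`abs1_L1`, `abs1_L2`, `abs1_L3` (`m1`): the sum of the pair coefficients of an outer pair at distance
two and of its inner pair is a single balanced-pair inequality of `T` (conjectures/MINE-B.md §32.5).
-/

namespace Summit.Ventures.PercRepro2.Tail2D

/-- **absorption**: an outer pair of weight `PO ≤ PI` and coefficient `cO` is paid for by an inner pair
of weight `PI` and coefficient `cI ≤ 0` as soon as `cO + cI ≤ 0`. -/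
lemma absorb {PO PI cO cI : ℝ} (hPO : 0 ≤ PO) (hPI : PO ≤ PI) (hcI : cI ≤ 0) (hsum : cO + cI ≤ 0) :
    PO * cO + PI * cI ≤ 0 := by
  rcases le_or_gt cO 0 with h | h
  · nlinarith [mul_nonneg hPO (neg_nonneg.2 h), mul_nonneg (le_trans hPO hPI) (neg_nonneg.2 hcI)]
  · nlinarith [mul_le_mul_of_nonneg_right hPI h.le, mul_nonneg (le_trans hPO hPI) (neg_nonneg.2 hsum)]

/-- a non-negative factor times a non-positive one -/
lemma mulnp {x y : ℝ} (hx : 0 ≤ x) (hy : y ≤ 0) : x * y ≤ 0 := by nlinarith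

/-- the second cancellation pattern: from `N Q ≤ M S` and `P M ≤ R N` conclude `P Q ≤ R S`
(all non-negative), provided `M N = 0` forces the conclusion -/
lemma chain' {P Q R S M N : ℝ} (hP : 0 ≤ P) (hQ : 0 ≤ Q) (hM : 0 ≤ M) (hN : 0 ≤ N)
    (hz : M * N = 0 → P * Q ≤ R * S) (h1 : N * Q ≤ M * S) (h2 : P * M ≤ R * N) : P * Q ≤ R * S := by
  by_cases hMN : M * N = 0
  · exact hz hMN
  · have hpos : 0 < M * N := lt_of_le_of_ne (mul_nonneg hM hN) (Ne.symm hMN)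
    have hprod := mul_le_mul h2 h1 (mul_nonneg hN hQ) (le_trans (mul_nonneg hP hM) h2)
    have key : P * Q * (M * N) ≤ R * S * (M * N) := by nlinarith [hprod]
    exact le_of_mul_le_mul_right key hpos

/-- the `m1` cross bracket: `T(u+e₁+e₂)·T(v) − T(u+e₁)·T(v+e₂)` -/
noncomputable def crossB1 (T : ℤ → ℤ → ℝ) (u₁ u₂ v₁ v₂ : ℤ) : ℝ :=
  T (u₁ + 1) (u₂ + 1) * T v₁ v₂ - T (u₁ + 1) u₂ * T v₁ (v₂ + 1)

namespace IsMTail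

variable {T : ℤ → ℤ → ℝ} {L : ℤ} (hT : IsMTail T L)

include hT

/-- `Δ₁ log T` is non-increasing on the cone `{d₁ ≥ 0, d₁ + d₂ ≥ 0}`: for `a ≤ a'`, `a + b ≤ a' + b'`,
`T(a'+1, b')·T(a, b) ≤ T(a+1, b)·T(a', b')` (the quadrant by `d1_quad`, the rest through `w`-steps) -/
lemma d1_cone {a b a' b' : ℤ} (h1 : a ≤ a') (h2 : a + b ≤ a' + b') :
    T (a' + 1) b' * T a b ≤ T (a + 1) b * T a' b' := by
  rcases le_or_gt b b' with hb | hb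
  · exact hT.d1_quad h1 hb
  · obtain ⟨k, hk, rfl⟩ : ∃ k : ℤ, 0 < k ∧ b' = b - k := ⟨b - b', by omega, by ring⟩
    obtain ⟨n, rfl⟩ : ∃ n : ℕ, a' = a + k + n := ⟨(a' - a - k).toNat, by omega⟩
    have s1 := hT.m2_iter a b (m := 0) (m' := k) hk.le
    simp only [add_zero, sub_zero] at s1
    have s2 := hT.d1_e1 (a + k) (b - k) n
    rw [show a + k + 1 + n = a + k + n + 1 by ring] at s2
    rw [show a + 1 + k = a + k + 1 by ring] at s1
    have hz : T (a + k + 1) (b - k) = 0 → T (a + k + n + 1) (b - k) * T a b = 0 := by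
      intro h0
      have : T (a + k + n + 1) (b - k) = 0 :=
        le_antisymm (h0 ▸ hT.anti₁_of_le (by omega) (b - k)) (hT.nonneg _ _)
      rw [this, zero_mul]
    exact ratio_chain (P := T (a + k + n + 1) (b - k)) (Q := T a b) (R := T (a + 1) b)
      (S := T (a + k + n) (b - k)) (M := T (a + k + 1) (b - k)) (N := T (a + k) (b - k))
      (hT.nonneg _ _) (hT.nonneg _ _) (hT.nonneg _ _) (hT.nonneg _ _) hz s1
      (by linarith [s2, mul_comm (T (a + k + n + 1) (b - k)) (T (a + k) (b - k)),
        mul_comm (T (a + k + 1) (b - k)) (T (a + k + n) (b - k))])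

/-- `Δ₂ log T` is non-increasing on the cone `{d₂ ≥ 0, d₁ + d₂ ≥ 0}`: for `b ≤ b'`, `a + b ≤ a' + b'`,
`T(a', b'+1)·T(a, b) ≤ T(a, b+1)·T(a', b')` (the quadrant by `d2_quad`, the rest through `-w`-steps) -/
lemma d2_cone {a b a' b' : ℤ} (h1 : b ≤ b') (h2 : a + b ≤ a' + b') :
    T a' (b' + 1) * T a b ≤ T a (b + 1) * T a' b' := by
  rcases le_or_gt a a' with ha | ha
  · exact hT.d2_quad ha h1
  · obtain ⟨k, hk, rfl⟩ : ∃ k : ℤ, 0 < k ∧ a' = a - k := ⟨a - a', by omega, by ring⟩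
    obtain ⟨n, rfl⟩ : ∃ n : ℕ, b' = b + k + n := ⟨(b' - b - k).toNat, by omega⟩
    -- the -w step from (a, b) to (a - k, b + k): m4_iter at the base (a - k, b + k)
    have s1 := hT.m4_iter (a - k) (b + k) (k := 0) (k' := k) hk.le
    simp only [add_zero, sub_zero] at s1
    rw [show a - k + k = a by ring, show b + k - k = b by ring, show b + k + 1 - k = b + 1 by ring] at s1
    -- s1 : T (a - k) (b + k + 1) * T a b ≤ T a (b + 1) * T (a - k) (b + k)
    have s2 := hT.d2_e2 (a - k) (b + k) n
    rw [show b + k + 1 + n = b + k + n + 1 by ring] at s2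
    -- s2 : T (a - k) (b + k + n + 1) * T (a - k) (b + k) ≤ T (a - k) (b + k + 1) * T (a - k) (b + k + n)
    have hz : T (a - k) (b + k + 1) = 0 → T (a - k) (b + k + n + 1) * T a b = 0 := by
      intro h0
      have : T (a - k) (b + k + n + 1) = 0 :=
        le_antisymm (h0 ▸ hT.anti₂_of_le (a - k) (by omega)) (hT.nonneg _ _)
      rw [this, zero_mul]
    exact ratio_chain (P := T (a - k) (b + k + n + 1)) (Q := T a b) (R := T a (b + 1))
      (S := T (a - k) (b + k + n)) (M := T (a - k) (b + k + 1)) (N := T (a - k) (b + k))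
      (hT.nonneg _ _) (hT.nonneg _ _) (hT.nonneg _ _) (hT.nonneg _ _) hz s1
      (by linarith [s2, mul_comm (T (a - k) (b + k + n + 1)) (T (a - k) (b + k)),
        mul_comm (T (a - k) (b + k + 1)) (T (a - k) (b + k + n))])

/-- the `m1` bracket is `≤ 0` when `u + e₁ − v` lies in the cone `{d₂ ≥ 0, d₁ + d₂ ≥ 0}` -/
lemma crossB1_nonpos {u₁ u₂ v₁ v₂ : ℤ} (h1 : v₂ ≤ u₂) (h2 : v₁ + v₂ ≤ u₁ + 1 + u₂) :
    crossB1 T u₁ u₂ v₁ v₂ ≤ 0 := by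
  unfold crossB1
  have := hT.d2_cone (a := v₁) (b := v₂) (a' := u₁ + 1) (b' := u₂) h1 h2
  linarith [this, mul_comm (T (u₁ + 1) (u₂ + 1)) (T v₁ v₂), mul_comm (T v₁ (v₂ + 1)) (T (u₁ + 1) u₂)]

/-- the product of `m1` at `u` and `m1` at `v` -/
lemma m1_mul_m1 (u₁ u₂ v₁ v₂ : ℤ) :
    (T (u₁ + 1) (u₂ + 1) * T u₁ u₂) * (T (v₁ + 1) (v₂ + 1) * T v₁ v₂)
      ≤ (T (u₁ + 1) u₂ * T u₁ (u₂ + 1)) * (T (v₁ + 1) v₂ * T v₁ (v₂ + 1)) :=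
  mul_le_mul (hT.m1 u₁ u₂) (hT.m1 v₁ v₂) (mul_nonneg (hT.nonneg _ _) (hT.nonneg _ _))
    (mul_nonneg (hT.nonneg _ _) (hT.nonneg _ _))

/-- **the `m1` pair-coefficient sign rule**: `crossB1 T u v + crossB1 T v u ≤ 0` whenever the two
points are at level distance at most one -/
theorem pair1_nonpos {u₁ u₂ v₁ v₂ : ℤ} (h : |u₁ + u₂ - (v₁ + v₂)| ≤ 1) :
    crossB1 T u₁ u₂ v₁ v₂ + crossB1 T v₁ v₂ u₁ u₂ ≤ 0 := by
  -- the bracket crossB1 u v is signed iff v₁ ≤ u₁ + 1 ∧ v₂ ≤ u₂; crossB1 v u iff u₁ ≤ v₁ + 1 ∧ u₂ ≤ v₂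
  rw [abs_le] at h
  by_cases huv : v₂ ≤ u₂ ∧ v₁ + v₂ ≤ u₁ + 1 + u₂
  · by_cases hvu : u₂ ≤ v₂ ∧ u₁ + u₂ ≤ v₁ + 1 + v₂
    · linarith [hT.crossB1_nonpos huv.1 huv.2, hT.crossB1_nonpos hvu.1 hvu.2]
    · -- crossB1 u v signed, crossB1 v u not: two_bracket with a - b = crossB1 u v
      have hs := hT.crossB1_nonpos huv.1 huv.2
      unfold crossB1 at hs ⊢
      have hcb : T (v₁ + 1) (v₂ + 1) * T u₁ u₂ ≤ T (u₁ + 1) u₂ * T v₁ (v₂ + 1) := by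
        -- Δ₁ log T non-increasing from (u₁, u₂) to (v₁, v₂ + 1)
        have := hT.d1_cone (a := u₁) (b := u₂) (a' := v₁) (b' := v₂ + 1) (by omega) (by omega)
        linarith [this, mul_comm (T (v₁ + 1) (v₂ + 1)) (T u₁ u₂)]
      have hprod := hT.m1_mul_m1 u₁ u₂ v₁ v₂
      have key := two_bracket (a := T (u₁ + 1) (u₂ + 1) * T v₁ v₂) (b := T (u₁ + 1) u₂ * T v₁ (v₂ + 1))
        (c := T (v₁ + 1) (v₂ + 1) * T u₁ u₂) (d := T (v₁ + 1) v₂ * T u₁ (u₂ + 1))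
        (mul_nonneg (hT.nonneg _ _) (hT.nonneg _ _)) (mul_nonneg (hT.nonneg _ _) (hT.nonneg _ _))
        (mul_nonneg (hT.nonneg _ _) (hT.nonneg _ _)) (by linarith [hs]) hcb (by nlinarith [hprod])
      linarith [key]
  · by_cases hvu : u₂ ≤ v₂ ∧ u₁ + u₂ ≤ v₁ + 1 + v₂
    · -- crossB1 v u signed, crossB1 u v not
      have hs := hT.crossB1_nonpos hvu.1 hvu.2
      unfold crossB1 at hs ⊢
      have hcb : T (u₁ + 1) (u₂ + 1) * T v₁ v₂ ≤ T (v₁ + 1) v₂ * T u₁ (u₂ + 1) := by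
        have := hT.d1_cone (a := v₁) (b := v₂) (a' := u₁) (b' := u₂ + 1) (by omega) (by omega)
        linarith [this, mul_comm (T (u₁ + 1) (u₂ + 1)) (T v₁ v₂)]
      have hprod := hT.m1_mul_m1 v₁ v₂ u₁ u₂
      have key := two_bracket (a := T (v₁ + 1) (v₂ + 1) * T u₁ u₂) (b := T (v₁ + 1) v₂ * T u₁ (u₂ + 1))
        (c := T (u₁ + 1) (u₂ + 1) * T v₁ v₂) (d := T (u₁ + 1) u₂ * T v₁ (v₂ + 1))
        (mul_nonneg (hT.nonneg _ _) (hT.nonneg _ _)) (mul_nonneg (hT.nonneg _ _) (hT.nonneg _ _))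
        (mul_nonneg (hT.nonneg _ _) (hT.nonneg _ _)) (by linarith [hs]) hcb (by nlinarith [hprod])
      linarith [key]
    · -- impossible at level distance ≤ 1
      exfalso; omega


/-! ### the three absorption lemmas of `m2` (offsets from `z = (a, b)`) -/

/-- the pair `{(2,0), (0,0)}` absorbed into `{(1,0), (1,0)}`: after the cancellations a single `w`-exchange -/
lemma abs2_E0 (a b : ℤ) :
    crossB T (a - 2) b a b + crossB T a b (a - 2) b + crossB T (a - 1) b (a - 1) b ≤ 0 := by
  unfold crossB
  have := hT.dw_cone (a := a - 2) (b := b) (a' := a + 1) (b' := b) (by omega) le_rfl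
  ring_nf at this ⊢
  linarith [this]

/-- the pair `{(2,0), (0,1)}` absorbed into `{(1,0), (1,1)}`: two `e₁`-exchanges along `2w` -/
lemma abs2_Em1 (a b : ℤ) :
    crossB T (a - 2) b a (b - 1) + crossB T a (b - 1) (a - 2) b
      + crossB T (a - 1) b (a - 1) (b - 1) + crossB T (a - 1) (b - 1) (a - 1) b ≤ 0 := by
  unfold crossB
  -- the single balanced pair T(a-2,b)·T(a+2,b-2) ≤ T(a,b-2)·T(a,b)
  have s1 := hT.m2_iter (a - 2) b (m := 0) (m' := 2) (by norm_num)
  simp only [add_zero, sub_zero] at s1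
  rw [show a - 2 + 1 + 2 = a + 1 by ring, show a - 2 + 1 = a - 1 by ring, show a - 2 + 2 = a by ring] at s1
  -- s1 : T (a+1) (b-2) * T (a-2) b ≤ T (a-1) b * T a (b-2)
  have s2 := hT.m2_iter (a - 1) b (m := 0) (m' := 2) (by norm_num)
  simp only [add_zero, sub_zero] at s2
  rw [show a - 1 + 1 + 2 = a + 2 by ring, show a - 1 + 1 = a by ring, show a - 1 + 2 = a + 1 by ring] at s2
  -- s2 : T (a+2) (b-2) * T (a-1) b ≤ T a b * T (a+1) (b-2)
  have hz : T (a - 1) b = 0 → T (a + 2) (b - 2) * T (a - 2) b = 0 := by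
    intro h0
    by_contra hne
    have h1 : 0 < T (a + 2) (b - 2) := lt_of_le_of_ne (hT.nonneg _ _) (fun h => hne (by rw [← h, zero_mul]))
    have h2 : 0 < T (a - 2) b := lt_of_le_of_ne (hT.nonneg _ _) (fun h => hne (by rw [← h, mul_zero]))
    rw [hT.pos_iff] at h1 h2
    rw [hT.eq_zero_iff] at h0
    omega
  have hz' : T (a - 1) b * T (a + 1) (b - 2) = 0 → T (a + 2) (b - 2) * T (a - 2) b ≤ T a b * T a (b - 2) := by
    intro h
    rcases mul_eq_zero.mp h with h | h
    · rw [hz h]; exact mul_nonneg (hT.nonneg _ _) (hT.nonneg _ _)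
    · have : T (a + 2) (b - 2) = 0 := le_antisymm (h ▸ hT.anti₁_of_le (by omega) (b - 2)) (hT.nonneg _ _)
      rw [this, zero_mul]; exact mul_nonneg (hT.nonneg _ _) (hT.nonneg _ _)
  have key := chain' (P := T (a + 2) (b - 2)) (Q := T (a - 2) b) (R := T a b) (S := T a (b - 2))
    (M := T (a - 1) b) (N := T (a + 1) (b - 2)) (hT.nonneg _ _) (hT.nonneg _ _) (hT.nonneg _ _)
    (hT.nonneg _ _) hz' s1 s2
  ring_nf at key ⊢
  linarith [key]

/-- the pair `{(2,0), (0,2)}` absorbed into `{(1,1), (1,1)}`: a single `e₁`-exchange along `3w` -/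
lemma abs2_Wm2 (a b : ℤ) :
    crossB T (a - 2) b a (b - 2) + crossB T a (b - 2) (a - 2) b + crossB T (a - 1) (b - 1) (a - 1) (b - 1) ≤ 0 := by
  unfold crossB
  have := hT.m2_iter (a - 2) b (m := 0) (m' := 3) (by norm_num)
  ring_nf at this ⊢
  linarith [this]

/-! ### the three absorption lemmas of `m1` -/

/-- the pair `{(2,0), (0,0)}` absorbed into `{(1,0), (1,0)}`: a single `e₂`-exchange along `3e₁` -/
lemma abs1_L1 (a b : ℤ) :
    crossB1 T (a - 2) b a b + crossB1 T a b (a - 2) b + crossB1 T (a - 1) b (a - 1) b ≤ 0 := by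
  unfold crossB1
  have := hT.d2_e1 (a - 2) b 3
  push_cast at this
  ring_nf at this ⊢
  linarith [this]

/-- the pair `{(0,2), (0,0)}` absorbed into `{(0,1), (0,1)}`: a single `e₁`-exchange along `3e₂` -/
lemma abs1_L2 (a b : ℤ) :
    crossB1 T a (b - 2) a b + crossB1 T a b a (b - 2) + crossB1 T a (b - 1) a (b - 1) ≤ 0 := by
  unfold crossB1
  have := hT.d1_e2 a (b - 2) 3
  push_cast at this
  ring_nf at this ⊢
  linarith [this]

/-- the pair `{(1,1), (0,0)}` absorbed into `{(0,1), (1,0)}`: two `e₂`-exchanges along `2e₁` -/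
lemma abs1_L3 (a b : ℤ) :
    crossB1 T (a - 1) (b - 1) a b + crossB1 T a b (a - 1) (b - 1)
      + crossB1 T a (b - 1) (a - 1) b + crossB1 T (a - 1) b a (b - 1) ≤ 0 := by
  unfold crossB1
  -- the single balanced pair T(a-1,b-1)·T(a+1,b+1) ≤ T(a-1,b+1)·T(a+1,b-1)
  have s1 := hT.d2_quad (a := a - 1) (b := b - 1) (a' := a + 1) (b' := b - 1) (by omega) le_rfl
  rw [show b - 1 + 1 = b by ring] at s1
  -- s1 : T (a+1) b * T (a-1) (b-1) ≤ T (a-1) b * T (a+1) (b-1)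
  have s2 := hT.d2_quad (a := a - 1) (b := b) (a' := a + 1) (b' := b) (by omega) le_rfl
  -- s2 : T (a+1) (b+1) * T (a-1) b ≤ T (a-1) (b+1) * T (a+1) b
  have hz : T (a - 1) b = 0 → T (a + 1) (b + 1) * T (a - 1) (b - 1) = 0 := by
    intro h0
    have : T (a + 1) (b + 1) = 0 := by
      have h1 := hT.anti₁_of_le (a := a - 1) (a' := a + 1) (by omega) (b + 1)
      have h2 := hT.anti₂ (a - 1) b
      rw [h0] at h2
      exact le_antisymm (le_trans h1 h2) (hT.nonneg _ _)
    rw [this, zero_mul]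
  have hz' : T (a - 1) b * T (a + 1) b = 0 → T (a + 1) (b + 1) * T (a - 1) (b - 1) ≤ T (a - 1) (b + 1) * T (a + 1) (b - 1) := by
    intro h
    rcases mul_eq_zero.mp h with h | h
    · rw [hz h]; exact mul_nonneg (hT.nonneg _ _) (hT.nonneg _ _)
    · have : T (a + 1) (b + 1) = 0 := le_antisymm (h ▸ hT.anti₂ (a + 1) b) (hT.nonneg _ _)
      rw [this, zero_mul]; exact mul_nonneg (hT.nonneg _ _) (hT.nonneg _ _)
  have key := chain' (P := T (a + 1) (b + 1)) (Q := T (a - 1) (b - 1)) (R := T (a - 1) (b + 1))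
    (S := T (a + 1) (b - 1)) (M := T (a - 1) b) (N := T (a + 1) b) (hT.nonneg _ _) (hT.nonneg _ _)
    (hT.nonneg _ _) (hT.nonneg _ _) hz' s1 s2
  ring_nf at key ⊢
  linarith [key]

end IsMTail

end Summit.Ventures.PercRepro2.Tail2D
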